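import Summits.CriticalPhenomena.PercolationContinuityZ3.Theorems.PercNearOneGluingNoHeavyLowerTailSahiCombFourStep
import Summits.CriticalPhenomena.PercolationContinuityZ3.Theorems.PercNearOneGluingNoHeavyLowerTailSahiCombTensorisation
import Literature.Combinatorics.Sahi2008.KahnIndependence

/-!
# The comb (tensor-Bernstein) hierarchy for Sahi's `E_k`, XV: PRIVATE COORDINATES CAN BE ELIMINATED (every `k`) — `E_k` is affine in `p_e`
# when `e` affects a single member; families with a bounded CORE

Support file of the one-cut programme (crux `NoHeavyLowerTail`, stmt-CriticalPhenomena-4575; cell `prim-masterthm`, seat P3, gen 3;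
`run/shared/lean/prim/prim-masterthm/prim-masterthm-p3/HIERARCHY.md` §10).  Vocabulary: `SahiComb.CombPos` (`…SahiCombPositivity`), sections `secAt e b`, supports `esupp`,
`Affects` (unit `prim-master-conj`, `SahiMasterFamilyMinors/Support`), `sahiE_eq_cons_succAbove` (`SahiMasterFamilySandwich`).

THE POINT.  A coordinate `e` is PRIVATE to the member `U_i` of a family of events if no other member depends on it.  Then in the set-partition form of
`E_{n+1}(μ_p; 1_U)` every product `Π_B μ_p(⋂_{j∈B} U_j)` has exactly one factor involving `U_i`, so `E_{n+1}` is AFFINE in `p_e`: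
  `E_{n+1}(μ_p; 1_U) = (1 − p_e)·E_{n+1}(μ_p; 1_{U[i ↦ U_i^{e←0}]}) + p_e·E_{n+1}(μ_p; 1_{U[i ↦ U_i^{e←1}]})`      (`sahiE_ind_private_eq`)
(the two section families live on the coordinates other than `e`).  We prove it from the Lieb–Sahi recursion through the FACTOR-OUT LEMMA
`sahiE_ind_update_inter_indep`: `E_{n+1}(1_{U_0},…,1_{H ∩ U_i},…,1_{U_n}) = μ_p(H)·E_{n+1}(1_U)` whenever `H` is determined by `F` and every `U_j` by `Fᶜ` (the slot-internal
form of independent splitting; induction on `n`, the recursion peeled at slot `i`).  Consequences: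
* `combPos_sahiE_ind_of_private` — COMB LEVEL: comb positivity of the two section families (multidegree `n+1`) gives comb positivity of the family (the sections ignore
  `p_e`, so `(1−p_e)·G⁰ + p_e·G¹` has multidegree `≤ n+1`); `sahiE_ind_nonneg_of_private` — law level;
* `combPos_sahiE_ind_of_core` / `sahiE_ind_nonneg_of_core` — ITERATED over all private coordinates: if every coordinate outside a set `S` affects at most one member
  ("`S` is a core of the family"), then comb positivity (resp. nonnegativity for every product measure) of EVERY family of increasing `S`-determined events at order `n+1`
  implies the same for the family.  So (M⁺-k) / (M-k) reduce to families WITHOUT private coordinates (every coordinate shared by ≥ 2 members), and every theorem about a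
  small cube `S` becomes a theorem about arbitrarily large families with core `S` (companion file `…SahiCombCore`: core of ≤ 3 coordinates ⇒ (M⁺-3); core of ≤ 4 coordinates ⇒
  Sahi's `E_n ≥ 0` for every `n`).
HONEST FRAMING: nothing here asserts (M⁺-k) or `C_k` for `k ≥ 3` in general. [this work]
-/

noncomputable section

open scoped Classical

namespace Summit.CriticalPhenomena.PercolationContinuityZ3.Theorems

open Finset Function MeasureTheory
open Literature.Combinatorics.Sahi2008
open Literature.Probability.LatticeModels (prodBernoulli prodBernoulli_real_inter_of_determinedBy prodBernoulli_real_setOf_mem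
  prodBernoulli_real_setOf_notMem)
open Literature.Probability.LatticeModels.Kahn2022 (Affects)
open Literature.Probability.Percolation (DeterminedBy determinedBy_iff)
open Literature.Probability.Percolation.DecisionTree (ind ind_of_mem ind_of_not_mem ind_nonneg)
open Literature.Probability.Percolation.BHK2006 (ind_inter)
open SahiComb SahiCombTensor

namespace SahiCombPrivate

variable {ι : Type} [Fintype ι]

/-! ### The factor-out lemma -/

/-- **Factor-out lemma**: intersecting ONE slot with an event `H` independent of the whole family multiplies `E_{n+1}` by `μ_p(H)`:
`E_{n+1}(1_{U_0},…,1_{H ∩ U_i},…,1_{U_n}) = μ_p(H)·E_{n+1}(1_{U_0},…,1_{U_n})` for `H` determined by `F` and every `U_j` by `Fᶜ`.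
(Induction on `n` along the Lieb–Sahi recursion peeled at slot `i`.) [this work] -/
theorem sahiE_ind_update_inter_indep (p : ι → unitInterval) (F : Finset ι) {H : Set (Set ι)} (hH : DeterminedBy H (↑F : Set ι)) :
    ∀ (n : ℕ) (U : Fin (n + 1) → Set (Set ι)) (i : Fin (n + 1)), (∀ j, DeterminedBy (U j) (↑F : Set ι)ᶜ) →
      sahiE (bernoulliWeight p) (n + 1) (update (fun j => ind (U j)) i (ind (H ∩ U i))) =
        (prodBernoulli p).real H * sahiE (bernoulliWeight p) (n + 1) (fun j => ind (U j))
  | 0, U, i, hU => by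
    have hi : i = 0 := Subsingleton.elim (α := Fin 1) i 0
    subst hi
    rw [sahiE_one_apply, sahiE_one_apply, update_self, ex_bernoulliWeight_ind, ex_bernoulliWeight_ind]
    exact prodBernoulli_real_inter_of_determinedBy p F hH (hU 0) MeasurableSet.of_discrete MeasurableSet.of_discrete
  | n + 1, U, i, hU => by
    have IH := sahiE_ind_update_inter_indep p F hH n
    have hind : (prodBernoulli p).real (H ∩ U i) = (prodBernoulli p).real H * (prodBernoulli p).real (U i) :=
      prodBernoulli_real_inter_of_determinedBy p F hH (hU i) MeasurableSet.of_discrete MeasurableSet.of_discrete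
    rw [sahiE_eq_cons_succAbove _ n (update (fun j => ind (U j)) i (ind (H ∩ U i))) i,
      sahiE_eq_cons_succAbove _ n (fun j => ind (U j)) i]
    have e1 : (Fin.cons (update (fun j => ind (U j)) i (ind (H ∩ U i)) i)
          (fun j => update (fun j => ind (U j)) i (ind (H ∩ U i)) (i.succAbove j)) : Fin (n + 2) → Set ι → ℝ) =
        Matrix.vecCons (ind (H ∩ U i)) (fun j => ind (U (i.succAbove j))) := by
      rw [update_self]
      have : (fun j => update (fun j => ind (U j)) i (ind (H ∩ U i)) (i.succAbove j)) = fun j => ind (U (i.succAbove j)) := by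
        funext j; rw [update_of_ne (Fin.succAbove_ne i j)]
      rw [this]; rfl
    have e2 : (Fin.cons (ind (U i)) (fun j => ind (U (i.succAbove j))) : Fin (n + 2) → Set ι → ℝ) =
        Matrix.vecCons (ind (U i)) (fun j => ind (U (i.succAbove j))) := rfl
    rw [e1, e2, sahiE_cons, sahiE_cons, ex_bernoulliWeight_ind, ex_bernoulliWeight_ind, hind]
    have hsum : ∀ i' : Fin (n + 1),
        sahiE (bernoulliWeight p) (n + 1)
            (update (fun j => ind (U (i.succAbove j))) i' (ind (U (i.succAbove i')) * ind (H ∩ U i))) =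
          (prodBernoulli p).real H * sahiE (bernoulliWeight p) (n + 1)
            (update (fun j => ind (U (i.succAbove j))) i' (ind (U (i.succAbove i')) * ind (U i))) := by
      intro i'
      set V : Fin (n + 1) → Set (Set ι) := update (fun j => U (i.succAbove j)) i' (U (i.succAbove i') ∩ U i) with hV
      have hVdet : ∀ j, DeterminedBy (V j) (↑F : Set ι)ᶜ := by
        intro j
        by_cases hj : j = i'
        · subst hj; simp only [hV, update_self]; exact (hU _).inter (hU _)
        · simp only [hV, update_of_ne hj]; exact hU _
      have key := IH V i' hVdet
      have eV1 : update (fun j => ind (V j)) i' (ind (H ∩ V i')) =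
          update (fun j => ind (U (i.succAbove j))) i' (ind (U (i.succAbove i')) * ind (H ∩ U i)) := by
        funext j
        by_cases hj : j = i'
        · subst hj
          simp only [update_self, hV]
          funext ω
          rw [Pi.mul_apply, ← ind_inter]
          congr 1; ext x; simp only [Set.mem_inter_iff]; tauto
        · simp only [update_of_ne hj, hV]
      have eV2 : (fun j => ind (V j)) = update (fun j => ind (U (i.succAbove j))) i' (ind (U (i.succAbove i')) * ind (U i)) := by
        funext j
        by_cases hj : j = i'
        · subst hj
          simp only [update_self, hV]
          funext ω
          rw [Pi.mul_apply, ← ind_inter]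
        · simp only [update_of_ne hj, hV]
      rw [← eV1, ← eV2]
      exact key
    rw [Finset.sum_congr rfl fun i' _ => hsum i', ← Finset.mul_sum]
    ring

/-! ### `E_{n+1}` is affine in a private coordinate -/

omit [Fintype ι] in
/-- Splitting an indicator along the coordinate `e`: `1_X = 1_{{e ∉ ω} ∩ X^{e←0}} + 1_{{e ∈ ω} ∩ X^{e←1}}`. [folklore] -/
theorem ind_eq_add_secAt (e : ι) (X : Set (Set ι)) :
    ind X = ind ({ω : Set ι | e ∉ ω} ∩ secAt e false X) + ind ({ω : Set ι | e ∈ ω} ∩ secAt e true X) := by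
  funext ω
  simp only [Pi.add_apply]
  by_cases he : e ∈ ω
  · have h1 : ω ∉ {ω : Set ι | e ∉ ω} ∩ secAt e false X := fun h => h.1 he
    have hsec : ω ∈ secAt e true X ↔ ω ∈ X := by
      rw [mem_secAt]; simp only [forceAt, cond_true, Set.insert_eq_of_mem he]
    rw [ind_of_not_mem h1, zero_add]
    by_cases hX : ω ∈ X
    · rw [ind_of_mem hX, ind_of_mem (show ω ∈ {ω : Set ι | e ∈ ω} ∩ secAt e true X from ⟨he, hsec.2 hX⟩)]
    · rw [ind_of_not_mem hX, ind_of_not_mem (fun h : ω ∈ {ω : Set ι | e ∈ ω} ∩ secAt e true X => hX (hsec.1 h.2))]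
  · have h1 : ω ∉ {ω : Set ι | e ∈ ω} ∩ secAt e true X := fun h => he h.1
    have hsec : ω ∈ secAt e false X ↔ ω ∈ X := by
      rw [mem_secAt]; simp only [forceAt, cond_false, Set.sdiff_singleton_eq_self he]
    rw [ind_of_not_mem h1, add_zero]
    by_cases hX : ω ∈ X
    · rw [ind_of_mem hX, ind_of_mem (show ω ∈ {ω : Set ι | e ∉ ω} ∩ secAt e false X from ⟨he, hsec.2 hX⟩)]
    · rw [ind_of_not_mem hX, ind_of_not_mem (fun h : ω ∈ {ω : Set ι | e ∉ ω} ∩ secAt e false X => hX (hsec.1 h.2))]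

/-- An increasing event not depending on `e` is determined by the other coordinates. [folklore] -/
theorem determinedBy_compl_of_not_affects {X : Set (Set ι)} (hX : IsUpperSet X) {e : ι} (he : ¬ Affects X e) :
    DeterminedBy X (↑({e} : Finset ι) : Set ι)ᶜ :=
  (determinedBy_esupp hX).mono fun x hx => by
    simp only [Finset.coe_singleton, Set.mem_compl_iff, Set.mem_singleton_iff]
    rintro rfl
    exact he (mem_esupp.1 (Finset.mem_coe.1 hx))

/-- The section families along a private coordinate are determined by the other coordinates. [this work] -/
theorem determinedBy_update_secAt {n : ℕ} (U : Fin (n + 1) → Set (Set ι)) (hU : ∀ j, IsUpperSet (U j)) (i : Fin (n + 1)) (e : ι)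
    (hpriv : ∀ j, j ≠ i → ¬ Affects (U j) e) (b : Bool) (j : Fin (n + 1)) :
    DeterminedBy (update U i (secAt e b (U i)) j) (↑({e} : Finset ι) : Set ι)ᶜ := by
  by_cases hj : j = i
  · subst hj
    rw [update_self]
    exact determinedBy_compl_of_not_affects (isUpperSet_secAt e b (hU j)) (not_affects_secAt e b (U j))
  · rw [update_of_ne hj]
    exact determinedBy_compl_of_not_affects (hU j) (hpriv j hj)

/-- **`E_{n+1}` is affine in a private coordinate.**  If no member other than `U_i` depends on the coordinate `e`, then
`E_{n+1}(μ_p; 1_U) = (1 − p_e)·E_{n+1}(μ_p; 1_{U[i ↦ U_i^{e←0}]}) + p_e·E_{n+1}(μ_p; 1_{U[i ↦ U_i^{e←1}]})`. [this work] -/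
theorem sahiE_ind_private_eq (p : ι → unitInterval) {n : ℕ} (U : Fin (n + 1) → Set (Set ι)) (hU : ∀ j, IsUpperSet (U j))
    (i : Fin (n + 1)) (e : ι) (hpriv : ∀ j, j ≠ i → ¬ Affects (U j) e) :
    sahiE (bernoulliWeight p) (n + 1) (fun j => ind (U j)) =
      (1 - (p e : ℝ)) * sahiE (bernoulliWeight p) (n + 1) (fun j => ind (update U i (secAt e false (U i)) j)) +
        (p e : ℝ) * sahiE (bernoulliWeight p) (n + 1) (fun j => ind (update U i (secAt e true (U i)) j)) := by
  have hsplit : (fun j => ind (U j)) = update (fun j => ind (U j)) i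
      (ind ({ω : Set ι | e ∉ ω} ∩ secAt e false (U i)) + ind ({ω : Set ι | e ∈ ω} ∩ secAt e true (U i))) := by
    rw [← ind_eq_add_secAt]; exact (update_eq_self i _).symm
  have piece : ∀ (b : Bool) (Hb : Set (Set ι)), DeterminedBy Hb (↑({e} : Finset ι) : Set ι) →
      sahiE (bernoulliWeight p) (n + 1) (update (fun j => ind (U j)) i (ind (Hb ∩ secAt e b (U i)))) =
        (prodBernoulli p).real Hb * sahiE (bernoulliWeight p) (n + 1) (fun j => ind (update U i (secAt e b (U i)) j)) := by
    intro b Hb hHb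
    have key := sahiE_ind_update_inter_indep p {e} hHb n (update U i (secAt e b (U i))) i
      (determinedBy_update_secAt U hU i e hpriv b)
    have e1 : update (fun j => ind (update U i (secAt e b (U i)) j)) i (ind (Hb ∩ update U i (secAt e b (U i)) i)) =
        update (fun j => ind (U j)) i (ind (Hb ∩ secAt e b (U i))) := by
      funext j
      by_cases hj : j = i
      · subst hj; simp only [update_self]
      · simp only [update_of_ne hj]
    rw [e1] at key
    exact key
  rw [hsplit, sahiE_update_add, piece false _ (Kahn2022.determinedBy_setOf_notMem e), piece true _ (Kahn2022.determinedBy_setOf_mem e),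
    prodBernoulli_real_setOf_notMem, prodBernoulli_real_setOf_mem]

/-! ### Comb- and law-level elimination of one private coordinate -/

/-- The section families ignore `p_e`. [this work] -/
theorem sahiE_update_secAt_update_eq {n : ℕ} (U : Fin (n + 1) → Set (Set ι)) (hU : ∀ j, IsUpperSet (U j)) (i : Fin (n + 1)) (e : ι)
    (hpriv : ∀ j, j ≠ i → ¬ Affects (U j) e) (b : Bool) (p : ι → unitInterval) (s : unitInterval) :
    sahiE (bernoulliWeight (update p e s)) (n + 1) (fun j => ind (update U i (secAt e b (U i)) j)) =
      sahiE (bernoulliWeight p) (n + 1) (fun j => ind (update U i (secAt e b (U i)) j)) := by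
  refine sahiE_bernoulliWeight_update_eq_of_diff p ({e} : Set ι) _ (fun j ω => ?_) (Set.mem_singleton e) s
  refine ind_eq_ind_of_inter_eq (S := (↑({e} : Finset ι) : Set ι)ᶜ) (determinedBy_update_secAt U hU i e hpriv b j) ?_
  ext x
  simp only [Finset.coe_singleton, Set.mem_inter_iff, Set.mem_compl_iff, Set.mem_singleton_iff, Set.mem_sdiff]
  tauto

/-- **Comb-level elimination of a private coordinate**: if no member other than `U_i` depends on `e` and both section families
`U[i ↦ U_i^{e←0}]`, `U[i ↦ U_i^{e←1}]` have `E_{n+1}` comb-positive at multidegree `n+1`, then so does `U`. [this work] -/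
theorem combPos_sahiE_ind_of_private {n : ℕ} (U : Fin (n + 1) → Set (Set ι)) (hU : ∀ j, IsUpperSet (U j)) (i : Fin (n + 1)) (e : ι)
    (hpriv : ∀ j, j ≠ i → ¬ Affects (U j) e)
    (h0 : CombPos (fun _ : ι => n + 1) (fun p => sahiE (bernoulliWeight p) (n + 1) (fun j => ind (update U i (secAt e false (U i)) j))))
    (h1 : CombPos (fun _ : ι => n + 1) (fun p => sahiE (bernoulliWeight p) (n + 1) (fun j => ind (update U i (secAt e true (U i)) j)))) :
    CombPos (fun _ : ι => n + 1) (fun p => sahiE (bernoulliWeight p) (n + 1) (fun j => ind (U j))) := by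
  have h0' := h0.of_ignores e (fun p s => sahiE_update_secAt_update_eq U hU i e hpriv false p s)
  have h1' := h1.of_ignores e (fun p s => sahiE_update_secAt_update_eq U hU i e hpriv true p s)
  have hdeg : Pi.single e 1 + update (fun _ : ι => n + 1) e 0 ≤ fun _ : ι => n + 1 := by
    intro x
    by_cases hx : x = e
    · subst hx; simp
    · simp [hx]
  have hA := ((combPos_one_sub_coord e).mul h0').mono hdeg
  have hB := ((combPos_coord e).mul h1').mono hdeg
  exact (hA.add hB).congr fun p => sahiE_ind_private_eq p U hU i e hpriv

/-- **Law-level elimination of a private coordinate**: nonnegativity of `E_{n+1}` for the two section families under every product measure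
gives it for `U`. [this work] -/
theorem sahiE_ind_nonneg_of_private {n : ℕ} (U : Fin (n + 1) → Set (Set ι)) (hU : ∀ j, IsUpperSet (U j)) (i : Fin (n + 1)) (e : ι)
    (hpriv : ∀ j, j ≠ i → ¬ Affects (U j) e)
    (h0 : ∀ p : ι → unitInterval, 0 ≤ sahiE (bernoulliWeight p) (n + 1) (fun j => ind (update U i (secAt e false (U i)) j)))
    (h1 : ∀ p : ι → unitInterval, 0 ≤ sahiE (bernoulliWeight p) (n + 1) (fun j => ind (update U i (secAt e true (U i)) j)))
    (p : ι → unitInterval) : 0 ≤ sahiE (bernoulliWeight p) (n + 1) (fun j => ind (U j)) := by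
  rw [sahiE_ind_private_eq p U hU i e hpriv]
  exact add_nonneg (mul_nonneg (sub_nonneg.2 (p e).2.2) (h0 p)) (mul_nonneg (p e).2.1 (h1 p))

/-! ### Iteration: families with a core -/

/-- A family all of whose supports lie in `S` consists of `S`-determined events. [folklore] -/
theorem determinedBy_of_esupp_sdiff_empty {X : Set (Set ι)} (hX : IsUpperSet X) {S : Finset ι} (h : esupp X \ S = ∅) :
    DeterminedBy X (↑S : Set ι) :=
  (determinedBy_esupp hX).mono fun x hx => by
    by_contra hxS
    have : x ∈ esupp X \ S := Finset.mem_sdiff.2 ⟨Finset.mem_coe.1 hx, fun h' => hxS (Finset.mem_coe.2 h')⟩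
    rw [h] at this
    exact Finset.notMem_empty x this

/-- Bookkeeping for the iteration: sectioning member `i` at a private coordinate `e ∈ esupp(U_i) ∖ S` keeps the family increasing, keeps every
coordinate outside `S` private, and lowers `Σ_j |esupp(U_j) ∖ S|`. [this work] -/
theorem private_step {n : ℕ} (S : Finset ι) (U : Fin (n + 1) → Set (Set ι)) (hU : ∀ j, IsUpperSet (U j))
    (hpriv : ∀ e, e ∉ S → ∀ j j', Affects (U j) e → Affects (U j') e → j = j')
    {i : Fin (n + 1)} {e : ι} (he : e ∈ esupp (U i) \ S) (b : Bool) :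
    (∀ j, IsUpperSet (update U i (secAt e b (U i)) j)) ∧
    (∀ e', e' ∉ S → ∀ j j', Affects (update U i (secAt e b (U i)) j) e' → Affects (update U i (secAt e b (U i)) j') e' → j = j') ∧
    (∑ j, (esupp (update U i (secAt e b (U i)) j) \ S).card + 1 ≤ ∑ j, (esupp (U j) \ S).card) := by
  have hmem : ∀ j x, Affects (update U i (secAt e b (U i)) j) x → Affects (U j) x := by
    intro j x hx
    by_cases hj : j = i
    · subst hj
      rw [update_self] at hx
      have := esupp_secAt_subset (hU j) e b (mem_esupp.2 hx)
      exact mem_esupp.1 (Finset.mem_of_mem_erase this)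
    · rwa [update_of_ne hj] at hx
  refine ⟨fun j => ?_, fun e' he' j j' hj hj' => hpriv e' he' j j' (hmem j e' hj) (hmem j' e' hj'), ?_⟩
  · by_cases hj : j = i
    · subst hj; rw [update_self]; exact isUpperSet_secAt e b (hU j)
    · rw [update_of_ne hj]; exact hU j
  · -- the `i`-th term drops by at least one, the others are unchanged
    have hle : ∀ j, (esupp (update U i (secAt e b (U i)) j) \ S).card ≤
        (if j = i then (esupp (U i) \ S).card - 1 else (esupp (U j) \ S).card) := by
      intro j
      by_cases hj : j = i
      · subst hj
        rw [if_pos rfl, update_self]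
        have hsub : esupp (secAt e b (U j)) \ S ⊆ (esupp (U j) \ S).erase e := by
          intro x hx
          obtain ⟨hx1, hx2⟩ := Finset.mem_sdiff.1 hx
          have hx3 := esupp_secAt_subset (hU j) e b hx1
          exact Finset.mem_erase.2 ⟨Finset.ne_of_mem_erase hx3, Finset.mem_sdiff.2 ⟨Finset.mem_of_mem_erase hx3, hx2⟩⟩
        have := Finset.card_le_card hsub
        rw [Finset.card_erase_of_mem he] at this
        exact this
      · rw [if_neg hj, update_of_ne hj]
    have hpos : 1 ≤ (esupp (U i) \ S).card := Finset.card_pos.2 ⟨e, he⟩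
    calc ∑ j, (esupp (update U i (secAt e b (U i)) j) \ S).card + 1
        ≤ ∑ j, (if j = i then (esupp (U i) \ S).card - 1 else (esupp (U j) \ S).card) + 1 :=
          Nat.add_le_add_right (Finset.sum_le_sum fun j _ => hle j) 1
      _ = ∑ j, (esupp (U j) \ S).card := by
          rw [← Finset.add_sum_erase univ _ (mem_univ i), ← Finset.add_sum_erase univ (fun j => (esupp (U j) \ S).card) (mem_univ i),
            if_pos rfl]
          have hrest : ∑ j ∈ univ.erase i, (if j = i then (esupp (U i) \ S).card - 1 else (esupp (U j) \ S).card) =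
              ∑ j ∈ univ.erase i, (esupp (U j) \ S).card :=
            Finset.sum_congr rfl fun j hj => by rw [if_neg (Finset.ne_of_mem_erase hj)]
          rw [hrest]
          omega

/-- **Comb-level private-coordinate elimination (core form).**  Let `S ⊆ ι` be a CORE of the family `U` of increasing events: every coordinate outside `S`
affects at most one member.  If every family of `n+1` increasing `S`-determined events has `E_{n+1}` comb-positive at multidegree `n+1`, then so does `U`.
(Induction on `Σ_j |esupp(U_j) ∖ S|`, one private coordinate at a time.) [this work] -/
theorem combPos_sahiE_ind_of_core (S : Finset ι) {n : ℕ}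
    (hS : ∀ V : Fin (n + 1) → Set (Set ι), (∀ j, IsUpperSet (V j)) → (∀ j, DeterminedBy (V j) (↑S : Set ι)) →
      CombPos (fun _ : ι => n + 1) (fun p => sahiE (bernoulliWeight p) (n + 1) (fun j => ind (V j)))) :
    ∀ (N : ℕ) (U : Fin (n + 1) → Set (Set ι)), (∀ j, IsUpperSet (U j)) → (∑ j, (esupp (U j) \ S).card) ≤ N →
      (∀ e, e ∉ S → ∀ j j', Affects (U j) e → Affects (U j') e → j = j') →
      CombPos (fun _ : ι => n + 1) (fun p => sahiE (bernoulliWeight p) (n + 1) (fun j => ind (U j))) := by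
  intro N
  induction N with
  | zero =>
    intro U hU hN _
    refine hS U hU fun j => determinedBy_of_esupp_sdiff_empty (hU j) (Finset.card_eq_zero.1 ?_)
    have := (Finset.sum_eq_zero_iff.1 (Nat.le_zero.1 hN)) j (mem_univ j)
    exact this
  | succ N ih =>
    intro U hU hN hpriv
    by_cases hall : ∀ j, esupp (U j) \ S = ∅
    · exact hS U hU fun j => determinedBy_of_esupp_sdiff_empty (hU j) (hall j)
    · obtain ⟨i, hi⟩ := not_forall.1 hall
      obtain ⟨e, he⟩ := Finset.nonempty_iff_ne_empty.2 hi
      have heS : e ∉ S := (Finset.mem_sdiff.1 he).2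
      have heU : Affects (U i) e := mem_esupp.1 (Finset.mem_sdiff.1 he).1
      have hpriv_i : ∀ j, j ≠ i → ¬ Affects (U j) e := fun j hj hje => hj (hpriv e heS j i hje heU)
      refine combPos_sahiE_ind_of_private U hU i e hpriv_i ?_ ?_
      · obtain ⟨h1, h2, h3⟩ := private_step S U hU hpriv he false
        exact ih _ h1 (by omega) h2
      · obtain ⟨h1, h2, h3⟩ := private_step S U hU hpriv he true
        exact ih _ h1 (by omega) h2

/-- **Law-level private-coordinate elimination (core form).**  Same with "comb-positive" replaced by "`E_{n+1}(μ_p) ≥ 0` for every `p`". [this work] -/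
theorem sahiE_ind_nonneg_of_core (S : Finset ι) {n : ℕ}
    (hS : ∀ V : Fin (n + 1) → Set (Set ι), (∀ j, IsUpperSet (V j)) → (∀ j, DeterminedBy (V j) (↑S : Set ι)) →
      ∀ p : ι → unitInterval, 0 ≤ sahiE (bernoulliWeight p) (n + 1) (fun j => ind (V j))) :
    ∀ (N : ℕ) (U : Fin (n + 1) → Set (Set ι)), (∀ j, IsUpperSet (U j)) → (∑ j, (esupp (U j) \ S).card) ≤ N →
      (∀ e, e ∉ S → ∀ j j', Affects (U j) e → Affects (U j') e → j = j') →
      ∀ p : ι → unitInterval, 0 ≤ sahiE (bernoulliWeight p) (n + 1) (fun j => ind (U j)) := by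
  intro N
  induction N with
  | zero =>
    intro U hU hN _
    refine hS U hU fun j => determinedBy_of_esupp_sdiff_empty (hU j) (Finset.card_eq_zero.1 ?_)
    exact (Finset.sum_eq_zero_iff.1 (Nat.le_zero.1 hN)) j (mem_univ j)
  | succ N ih =>
    intro U hU hN hpriv
    by_cases hall : ∀ j, esupp (U j) \ S = ∅
    · exact hS U hU fun j => determinedBy_of_esupp_sdiff_empty (hU j) (hall j)
    · obtain ⟨i, hi⟩ := not_forall.1 hall
      obtain ⟨e, he⟩ := Finset.nonempty_iff_ne_empty.2 hi
      have heS : e ∉ S := (Finset.mem_sdiff.1 he).2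
      have heU : Affects (U i) e := mem_esupp.1 (Finset.mem_sdiff.1 he).1
      have hpriv_i : ∀ j, j ≠ i → ¬ Affects (U j) e := fun j hj hje => hj (hpriv e heS j i hje heU)
      refine sahiE_ind_nonneg_of_private U hU i e hpriv_i ?_ ?_
      · obtain ⟨h1, h2, h3⟩ := private_step S U hU hpriv he false
        exact ih _ h1 (by omega) h2
      · obtain ⟨h1, h2, h3⟩ := private_step S U hU hpriv he true
        exact ih _ h1 (by omega) h2

/-- **Families with a core `S`, comb level** (the bound-free wrapper). [this work] -/
theorem combPos_sahiE_ind_of_core' (S : Finset ι) {n : ℕ}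
    (hS : ∀ V : Fin (n + 1) → Set (Set ι), (∀ j, IsUpperSet (V j)) → (∀ j, DeterminedBy (V j) (↑S : Set ι)) →
      CombPos (fun _ : ι => n + 1) (fun p => sahiE (bernoulliWeight p) (n + 1) (fun j => ind (V j))))
    (U : Fin (n + 1) → Set (Set ι)) (hU : ∀ j, IsUpperSet (U j))
    (hpriv : ∀ e, e ∉ S → ∀ j j', Affects (U j) e → Affects (U j') e → j = j') :
    CombPos (fun _ : ι => n + 1) (fun p => sahiE (bernoulliWeight p) (n + 1) (fun j => ind (U j))) :=
  combPos_sahiE_ind_of_core S hS _ U hU le_rfl hpriv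

/-- **Families with a core `S`, law level** (the bound-free wrapper). [this work] -/
theorem sahiE_ind_nonneg_of_core' (S : Finset ι) {n : ℕ}
    (hS : ∀ V : Fin (n + 1) → Set (Set ι), (∀ j, IsUpperSet (V j)) → (∀ j, DeterminedBy (V j) (↑S : Set ι)) →
      ∀ p : ι → unitInterval, 0 ≤ sahiE (bernoulliWeight p) (n + 1) (fun j => ind (V j)))
    (U : Fin (n + 1) → Set (Set ι)) (hU : ∀ j, IsUpperSet (U j))
    (hpriv : ∀ e, e ∉ S → ∀ j j', Affects (U j) e → Affects (U j') e → j = j') (p : ι → unitInterval) :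
    0 ≤ sahiE (bernoulliWeight p) (n + 1) (fun j => ind (U j)) :=
  sahiE_ind_nonneg_of_core S hS _ U hU le_rfl hpriv p

end SahiCombPrivate

end Summit.CriticalPhenomena.PercolationContinuityZ3.Theorems

end
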